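import Mathlib
import HarnessLib
import Literature.Geometry.Lorentzian.Stationary
import Literature.Geometry.Lorentzian.IPlusRegular
import Literature.Geometry.Lorentzian.Geodesic
import Literature.Geometry.Lorentzian.Einstein
import Literature.Geometry.Lorentzian.Causality

/-!
# Sketch — crux-ideate stmt-FinalStateConjecture-13896 (NonTrappingHawkingRigidity), ideator 2

First lemmas of the two idea cards (they must elaborate; they are not proved here):

* `AzimuthalTataruLiouville` — card `azimuthal-time-tataru`: on a stationary background carrying a
  second `T`-commuting Killing field `Φ`, in the region where NO zero-energy null vector is
  orthogonal to `Φ` (⇔ the Killing orbit `span{T,Φ}` is a timelike line or plane), every smooth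
  `T`-invariant solution of `□u + Vu + du(Y) = 0` (with `T`- and `Φ`-invariant lower-order data)
  which vanishes off the `T`-orbit of a compact set vanishes identically — provided a `T`-invariant
  sweep function with spacelike gradient exists there.  Engine: Tataru–Robbiano–Zuily–Hörmander
  unique continuation under partial analyticity (coefficients independent of the Killing parameter
  of `Φ`; the residual characteristic set `Char ∩ {ξ(T)=0} ∩ {ξ(Φ)=0}` is EMPTY by hypothesis), no
  non-trapping, no separability, no multiplier.
* `IsAzimuthalTime` — the object shared by both cards: a circle-valued `T`-invariant function on a
  `T`-invariant region whose level sets are SPACELIKE hypersurfaces containing `T` (possible only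
  where `T` is spacelike: the ergoregion belt).  On Kerr's ergoregion the Boyer–Lindquist azimuth
  `φ` is one (`g^{φφ} = g_tt / (g_tt g_φφ − g_tφ²) < 0` there).
* `AxisymmetricStuffingRigidity` — card `azimuthal-c-energy`, first fruit: a smooth stationary
  Ricci-flat metric that agrees with a stationary–AXISYMMETRIC one off the `T`-orbit of a compact
  subset of the region where the orbit planes are timelike, and whose belt admits an azimuthal time,
  inherits the axial Killing field.
-/

noncomputable section

open scoped Manifold ContDiff Topology
open Set Literature.Geometry.Lorentzian

namespace Summit.FinalStateConjecture.FinalStateConjecture.Cruxes.NonTrappingHawkingRigidity.Ideator2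

/-- **No zero-energy null vector orthogonal to `Φ` on `W`** (Tataru's residual characteristic set
`Char □ ∩ {ξ(T) = 0} ∩ {ξ(Φ) = 0}` is empty over `W`): equivalently the Killing orbit
`span{T x, Φ x}` is a timelike line or a timelike 2-plane at every `x ∈ W`. -/
def NoAxialFreeZeroEnergyLight (𝓑 : StationaryAFBlackHole.{0})
    (Φ : Π x : 𝓑.carrier, TangentSpace (𝓡 4) x) (W : Set 𝓑.carrier) : Prop :=
  ∀ x ∈ W, ∀ v : TangentSpace (𝓡 4) x,
    𝓑.metric.val x v v = 0 → 𝓑.metric.val x v (𝓑.killing x) = 0 → 𝓑.metric.val x v (Φ x) = 0 →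
      v = 0

/-- **A `T`-invariant sweep function with spacelike gradient on `W`**: `ψ` smooth on `W`,
`dψ(T) = 0`, and `dψ = g(w, ·)` for a spacelike `w` at every point of `W` (so the level sets of
`ψ` are `T`-invariant TIMELIKE hypersurfaces, non-characteristic for the `T`-reduced wave
operator).  On Kerr, `ψ = r` (Boyer–Lindquist / Kerr–Schild radius) is one on the exterior. -/
def HasTimelikeSweep (𝓑 : StationaryAFBlackHole.{0}) (W : Set 𝓑.carrier) : Prop :=
  ∃ ψ : 𝓑.carrier → ℝ, ContMDiffOn (𝓡 4) 𝓘(ℝ, ℝ) ((⊤ : ℕ∞) : WithTop ℕ∞) ψ W ∧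
    ∀ x ∈ W, mfderiv (𝓡 4) 𝓘(ℝ, ℝ) ψ x (𝓑.killing x) = 0 ∧
      ∃ w : TangentSpace (𝓡 4) x, 0 < 𝓑.metric.val x w w ∧
        ∀ u : TangentSpace (𝓡 4) x, mfderiv (𝓡 4) 𝓘(ℝ, ℝ) ψ x u = 𝓑.metric.val x w u

/-- **First lemma of card `azimuthal-time-tataru` (AZIMUTHAL TATARU–LIOUVILLE, scalar model with
arbitrary invariant lower-order terms).**  Let `Φ` be smooth and Killing on the d.o.c. with
`[T, Φ] = 0`; let `S ⊆ doc` be compact and `W ⊆ doc` an open set containing `orbit_T(S)` on which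
no zero-energy null vector is orthogonal to `Φ` and which carries a `T`-invariant sweep function
with spacelike gradient.  Then every smooth `T`-invariant `u` on the d.o.c. solving
`□u + V·u + du(Y) = 0` there, with `V`, `Y` smooth and invariant under `T` and `Φ` on `W`, and
with `u = 0` on `doc ∖ orbit_T(S)`, vanishes on the d.o.c.  (Tataru 1995 Thm 2 /
Robbiano–Zuily 1998 / Hörmander 1997 applied on the quotient `W/T` in coordinates adapted to `Φ`;
the conormal pseudo-convexity condition is void because the residual characteristic set is empty;
sweep by the timelike level sets of `ψ`.)  Decides the Pohozaev line's
`ScalarPairLiouvilleWithLowerOrder` question on axisymmetric backgrounds and contains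
`BeltLiouville.KerrStationaryScalarLiouville` (Kerr: `ψ = r`, orbit planes timelike off the axis,
`T` timelike on the axis outside `𝓗⁺`).  NO non-trapping hypothesis. -/
def AzimuthalTataruLiouville : Prop :=
  ∀ (𝓑 : StationaryAFBlackHole.{0}) [𝓑.metric.HasLeviCivita],
  ∀ (Φ : Π x : 𝓑.carrier, TangentSpace (𝓡 4) x),
    ContMDiffOn (𝓡 4) ((𝓡 4).prod 𝓘(ℝ, E4)) ((⊤ : ℕ∞) : WithTop ℕ∞)
      (fun x ↦ (Bundle.TotalSpace.mk' E4 x (Φ x) : TangentBundle (𝓡 4) 𝓑.carrier)) 𝓑.doc →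
    (∀ x ∈ 𝓑.doc, ∀ v w : TangentSpace (𝓡 4) x,
      𝓑.metric.val x (𝓑.metric.leviCivita Φ x v) w + 𝓑.metric.val x v (𝓑.metric.leviCivita Φ x w)
        = 0) →
    (∀ x ∈ 𝓑.doc, VectorField.mlieBracket (𝓡 4) 𝓑.killing Φ x = 0) →
  ∀ (S W : Set 𝓑.carrier), IsCompact S → S ⊆ 𝓑.doc → IsOpen W → W ⊆ 𝓑.doc →
    stationaryOrbit 𝓑.killing S ⊆ W →
    NoAxialFreeZeroEnergyLight 𝓑 Φ W → HasTimelikeSweep 𝓑 W →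
  ∀ (u V : 𝓑.carrier → ℝ) (Y : Π x : 𝓑.carrier, TangentSpace (𝓡 4) x),
    ContMDiffOn (𝓡 4) 𝓘(ℝ, ℝ) ((⊤ : ℕ∞) : WithTop ℕ∞) u 𝓑.doc →
    ContMDiffOn (𝓡 4) 𝓘(ℝ, ℝ) ((⊤ : ℕ∞) : WithTop ℕ∞) V W →
    ContMDiffOn (𝓡 4) ((𝓡 4).prod 𝓘(ℝ, E4)) ((⊤ : ℕ∞) : WithTop ℕ∞)
      (fun x ↦ (Bundle.TotalSpace.mk' E4 x (Y x) : TangentBundle (𝓡 4) 𝓑.carrier)) W →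
    (∀ x ∈ 𝓑.doc, mfderiv (𝓡 4) 𝓘(ℝ, ℝ) u x (𝓑.killing x) = 0) →
    (∀ x ∈ W, mfderiv (𝓡 4) 𝓘(ℝ, ℝ) V x (𝓑.killing x) = 0 ∧ mfderiv (𝓡 4) 𝓘(ℝ, ℝ) V x (Φ x) = 0) →
    (∀ x ∈ W, VectorField.mlieBracket (𝓡 4) 𝓑.killing Y x = 0 ∧
      VectorField.mlieBracket (𝓡 4) Φ Y x = 0) →
    (∀ x ∈ 𝓑.doc, mfderiv (𝓡 4) 𝓘(ℝ, ℝ) u x (Y x) = -(𝓑.metric.dalembertian u x + V x * u x)) →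
    (∀ x ∈ 𝓑.doc, x ∉ stationaryOrbit 𝓑.killing S → u x = 0) →
  ∀ x ∈ 𝓑.doc, u x = 0

/-- **AZIMUTHAL TIME on a `T`-invariant region `B`** (the object of both cards): a smooth
circle-valued function `θ : carrier → Circle`, defined near `B`, with `dθ(T) = 0` and whose
kernel at each point of `B` is the orthogonal complement of a TIMELIKE vector — i.e. `dθ ≠ 0` and
the level sets of `θ` are spacelike hypersurfaces containing the (necessarily spacelike) `T`.  In
the `T`-quotient this is a circle-valued time function for the reduced Lorentzian metric
`h = X g − T♭ ⊗ T♭`, `X = g(T,T) > 0`; on Kerr's open ergoregion `θ = e^{iφ}` works. -/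
def IsAzimuthalTime (𝓑 : StationaryAFBlackHole.{0}) (B : Set 𝓑.carrier)
    (θ : 𝓑.carrier → Circle) : Prop :=
  ∃ O : Set 𝓑.carrier, IsOpen O ∧ B ⊆ O ∧ ContMDiffOn (𝓡 4) (𝓡 1) ((⊤ : ℕ∞) : WithTop ℕ∞) θ O ∧
    ∀ x ∈ B, mfderiv (𝓡 4) (𝓡 1) θ x (𝓑.killing x) = 0 ∧ mfderiv (𝓡 4) (𝓡 1) θ x ≠ 0 ∧
      ∃ v : TangentSpace (𝓡 4) x, 𝓑.metric.val x v v < 0 ∧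
        ∀ w : TangentSpace (𝓡 4) x, 𝓑.metric.val x v w = 0 → mfderiv (𝓡 4) (𝓡 1) θ x w = 0

/-- **First fruit of card `azimuthal-c-energy` (AXISYMMETRIC STUFFING RIGIDITY, no Carleman, no
exposed point).**  Let `𝓑` carry a second field `Φ`, smooth and Killing on the d.o.c., commuting
with `T`.  Let `g'` be another smooth Lorentzian metric on the carrier, Ricci-flat, for which `T`
is again a Killing field, and which coincides with `g` off the `T`-orbit of a compact `S ⊆ doc`;
suppose that near `orbit_T(S)` the `g`-orbit planes `span{T,Φ}` are timelike
(`NoAxialFreeZeroEnergyLight`) and that `orbit_T(S)` admits an azimuthal time FOR `g'`.  Then `Φ`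
extends from the complement to a `g'`-Killing field on the d.o.c. commuting with `T`:
the "stuffing" is axisymmetric (hence, by elliptic analytic continuation on the Ernst side, absent).
Mechanism: reduce `g'` along the spacelike `T` on the belt (2+1 Lorentzian quotient + wave map into
`ℍ²`, positive energy); the 2+1 Hamiltonian constraint makes the energy of every azimuthal-time
slice a boundary term frozen by the axisymmetric exterior, and Mazur–Bunting convexity of the
`ℍ²` Dirichlet energy forces the azimuthal kinetic energy to vanish. -/
def AxisymmetricStuffingRigidity : Prop :=
  ∀ (𝓑 : StationaryAFBlackHole.{0}) [𝓑.metric.HasLeviCivita],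
  ∀ (Φ : Π x : 𝓑.carrier, TangentSpace (𝓡 4) x),
    ContMDiffOn (𝓡 4) ((𝓡 4).prod 𝓘(ℝ, E4)) ((⊤ : ℕ∞) : WithTop ℕ∞)
      (fun x ↦ (Bundle.TotalSpace.mk' E4 x (Φ x) : TangentBundle (𝓡 4) 𝓑.carrier)) 𝓑.doc →
    (∀ x ∈ 𝓑.doc, ∀ v w : TangentSpace (𝓡 4) x,
      𝓑.metric.val x (𝓑.metric.leviCivita Φ x v) w + 𝓑.metric.val x v (𝓑.metric.leviCivita Φ x w)
        = 0) →
    (∀ x ∈ 𝓑.doc, VectorField.mlieBracket (𝓡 4) 𝓑.killing Φ x = 0) →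
  ∀ (S W : Set 𝓑.carrier), IsCompact S → S ⊆ 𝓑.doc → IsOpen W → W ⊆ 𝓑.doc →
    stationaryOrbit 𝓑.killing S ⊆ W → NoAxialFreeZeroEnergyLight 𝓑 Φ W →
  ∀ (g' : LorentzianMetric (𝓡 4) ∞ 𝓑.carrier) [g'.HasLeviCivita],
    g'.toPseudoRiemannianMetric.IsRicciFlat →
    g'.toPseudoRiemannianMetric.IsKillingField 𝓑.killing →
    (∀ x, x ∉ stationaryOrbit 𝓑.killing S → g'.val x = 𝓑.metric.val x) →
    (∃ θ : 𝓑.carrier → Circle, ∃ O : Set 𝓑.carrier, IsOpen O ∧ stationaryOrbit 𝓑.killing S ⊆ O ∧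
      ContMDiffOn (𝓡 4) (𝓡 1) ((⊤ : ℕ∞) : WithTop ℕ∞) θ O ∧
      ∀ x ∈ stationaryOrbit 𝓑.killing S, mfderiv (𝓡 4) (𝓡 1) θ x (𝓑.killing x) = 0 ∧
        mfderiv (𝓡 4) (𝓡 1) θ x ≠ 0 ∧ ∃ v : TangentSpace (𝓡 4) x, g'.val x v v < 0 ∧
          ∀ w : TangentSpace (𝓡 4) x, g'.val x v w = 0 → mfderiv (𝓡 4) (𝓡 1) θ x w = 0) →
  ∃ Φ' : Π x : 𝓑.carrier, TangentSpace (𝓡 4) x,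
    ContMDiffOn (𝓡 4) ((𝓡 4).prod 𝓘(ℝ, E4)) ((⊤ : ℕ∞) : WithTop ℕ∞)
      (fun x ↦ (Bundle.TotalSpace.mk' E4 x (Φ' x) : TangentBundle (𝓡 4) 𝓑.carrier)) 𝓑.doc ∧
    (∀ x ∈ 𝓑.doc, ∀ v w : TangentSpace (𝓡 4) x,
      g'.val x (g'.leviCivita Φ' x v) w + g'.val x v (g'.leviCivita Φ' x w) = 0) ∧
    (∀ x ∈ 𝓑.doc, VectorField.mlieBracket (𝓡 4) 𝓑.killing Φ' x = 0) ∧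
    ∀ x ∈ 𝓑.doc, x ∉ stationaryOrbit 𝓑.killing S → Φ' x = Φ x

end Summit.FinalStateConjecture.FinalStateConjecture.Cruxes.NonTrappingHawkingRigidity.Ideator2

end
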